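import Literature.Geometry.Riemannian.GurskyEinsteinGapProofs
import Literature.Analysis.Matrix.KyFanMaximumPrinciple
import Summits.NavierStokesRegularity.NavierStokesRegularity.Theorems.TypeICertificateLadderTargetStrainCubePointwise
import HarnessLib

/-!
# Route `ExtremiserTransience` (crux `NearExtremalTransience`, stmt-NavierStokesRegularity-21883) — structure
# of near-extremisers, static part: MILLER'S DETERMINANT BOUND WITH A SHARP STABILITY TERM

`--supports stmt-NavierStokesRegularity-21883` (helper). The route's layer-2 plan names «the identification
of the extremal configuration (axisymmetric strain `diag(1,1,−2)` …) — the equality case of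
`strainCube_pointwise_links_attained`» and «profile compactness of near-maximisers of `R`» as the static
children of the crux; the director's ceiling-lift word is «structure of near-extremisers». The first
pointwise link of the depletion chain is Betchov's `∫⟪ω, Du ω⟫ = −4∫det S` followed by Miller's bound
`|4 det S| ≤ (2√6/9)|S|³` for trace-free symmetric `S` (`abs_four_det_sym_le`, Miller 2020 Prop. 4.8 =
tree `GurskyLeBrun.det_le_normSq_mul_sqrt`); its equality case («iff two eigenvalues coincide») was NOT
formalised. This file proves the QUANTITATIVE equality case with the sharp constant:

* `DepletionLadder.StrainCube.millerStability_scalar` — eigenvalue form: for `a + b + c = 0` with `ab ≥ 0`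
  (i.e. `c` is the eigenvalue of the odd sign = of maximal modulus),
  `4|abc| + (8√6/9)√σ (σ − (3/2)c²) ≤ (2√6/9) σ√σ`, `σ = a² + b² + c²`
  (the difference is `4ab((√6/3)√σ − |c|) ≥ 0`).
* `DepletionLadder.StrainCube.frobeniusSq_sub_uniaxial` — for ANY trace-free `W` and unit vector `e` with
  Rayleigh quotient `μ = eᵀWe`: `|W − (μ/2)(3e⊗e − I)|²_F = |W|²_F − (3/2)μ²` (exact identity; in particular the
  operator-norm link `μ² ≤ (2/3)|W|²` of the chain (`abs_quadForm_sym_le`) holds with DEFICIT EQUAL to the squared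
  Frobenius distance from `W` to the uniaxial shape with axis `e`).
* `DepletionLadder.StrainCube.miller_det_stability` — **MILLER'S BOUND WITH STABILITY**: for a real
  symmetric trace-free `3 × 3` matrix `W` there is a unit vector `e` (an eigenvector of the odd-sign eigenvalue)
  such that, with `μ = eᵀWe`,
  `4|det W| + (8√6/9)·|W|·|W − (μ/2)(3e⊗e − I)|²_F ≤ (2√6/9)|W|³`.
  Consequently near-equality in Miller's bound forces `W` to be Frobenius-close to the uniaxial
  («axisymmetric», Lund–Rogers `s* = ±1`) shape `(μ/2)(3e⊗e − I)`: the constant `8√6/9 = 4·(2√6/9)` is SHARP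
  (equality at the uniaxial shapes AND at plane strain `diag(1,0,−1)`, `miller_det_stability_sharp_planeStrain`).
* `DepletionLadder.StrainCube.abs_four_det_sym_stability` — the same in the `(g, s)`-array vocabulary of
  `…StrainCubePointwise` (symmetric part `s` of a trace-free velocity-gradient array `g`).

Integrated reading (not formalised here: it needs a measurable choice of `e(x)`): along the chain
`|∫⟪ω,Duω⟫| = 4|∫det S| ≤ (2√6/9)∫|S|³`, a flow-wise strain-state factor `Λ♭ = 4|∫det S|/((2√6/9)∫|S|³) ≥ 1 − ε`
(nsreg-p3 ROUND-24 notation) forces `∫|S|·dist(S, uniaxial)² ≤ (ε/4)∫|S|³` — the `|S|³`-weighted mean-square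
distance of the normalised strain from the `s* = ±1` shapes is at most `ε/4`.

WHAT THIS IS NOT: pointwise linear algebra only; nothing about Navier–Stokes solutions, no depletion constant
and no statement about the crux beyond the structure of exact/near extremisers of its first pointwise link.
References: E. Miller, Arch. Ration. Mech. Anal. 235 (2020), Prop. 4.8 (equality case); T. S. Lund,
M. M. Rogers, Phys. Fluids 6 (1994) 1838 (the strain-state parameter `s*`). [folklore]
-/

noncomputable section

open Finset Matrix
open scoped RealInnerProductSpace

namespace Summit.NavierStokesRegularity.NavierStokesRegularity.Theorems.DepletionLadder.StrainCube

-- the problem directory repeats the summit name (`NavierStokesRegularity/NavierStokesRegularity`)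
set_option linter.dupNamespace false

open Literature.Geometry.Riemannian.GurskyLeBrun Literature.Analysis.Matrix

/-! ### 1. Scalar (eigenvalue) form -/

/-- Among three real numbers two have a nonnegative product. [folklore] -/
theorem exists_pair_mul_nonneg (x y z : ℝ) : 0 ≤ x * y ∨ 0 ≤ x * z ∨ 0 ≤ y * z := by
  by_contra h
  push Not at h
  obtain ⟨h1, h2, h3⟩ := h
  have h4 : 0 < (x * y) * (x * z) := mul_pos_of_neg_of_neg h1 h2
  have h5 : (x * y) * (x * z) = x ^ 2 * (y * z) := by ring
  rw [h5] at h4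
  nlinarith [sq_nonneg x, mul_nonpos_iff.2 (Or.inl ⟨sq_nonneg x, h3.le⟩)]

/-- **Miller's bound with stability, eigenvalue form.** For real `a, b, c` with `a + b + c = 0` and
`ab ≥ 0` (so `c = −(a+b)` is the eigenvalue of the odd sign, of maximal modulus), with `σ = a² + b² + c²`:
`4|abc| + (8√6/9)·√σ·(σ − (3/2)c²) ≤ (2√6/9)·σ√σ`. Here `σ − (3/2)c² = (a−b)²/2 ≥ 0` is the squared
distance of `diag(a,b,c)` from the uniaxial shape `diag(−c/2, −c/2, c)`, and the difference of the two
sides is `4ab((√6/3)√σ − |c|) ≥ 0` (`c² ≤ (2/3)σ`). Equality iff `ab = 0` (plane strain) or `a = b`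
(uniaxial). [folklore] -/
theorem millerStability_scalar {a b c : ℝ} (h : a + b + c = 0) (hab : 0 ≤ a * b) :
    4 * |a * b * c| + 8 / 9 * Real.sqrt 6 * Real.sqrt (a ^ 2 + b ^ 2 + c ^ 2) *
        ((a ^ 2 + b ^ 2 + c ^ 2) - 3 / 2 * c ^ 2) ≤
      2 / 9 * Real.sqrt 6 * ((a ^ 2 + b ^ 2 + c ^ 2) * Real.sqrt (a ^ 2 + b ^ 2 + c ^ 2)) := by
  have hc : c = -(a + b) := by linarith
  set s : ℝ := Real.sqrt (a ^ 2 + b ^ 2 + c ^ 2) with hs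
  have hσ0 : 0 ≤ a ^ 2 + b ^ 2 + c ^ 2 := by positivity
  have hs0 : 0 ≤ s := Real.sqrt_nonneg _
  have hs2 : s ^ 2 = a ^ 2 + b ^ 2 + c ^ 2 := Real.sq_sqrt hσ0
  have h60 : 0 ≤ Real.sqrt 6 := Real.sqrt_nonneg _
  have h6 : Real.sqrt 6 ^ 2 = 6 := Real.sq_sqrt (by norm_num)
  -- `|c| ≤ (√6/3) s`, i.e. `c² ≤ (2/3) σ`
  have hc2 : c ^ 2 ≤ (Real.sqrt 6 / 3 * s) ^ 2 := by
    rw [mul_pow, div_pow, h6, hs2, hc]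
    nlinarith [sq_nonneg (a - b)]
  have hcle : |c| ≤ Real.sqrt 6 / 3 * s := abs_le_of_sq_le_sq (by simpa using hc2) (by positivity)
  -- `|abc| = ab|c|`
  have habs : |a * b * c| = a * b * |c| := by rw [abs_mul, abs_of_nonneg hab]
  -- the difference is `4ab((√6/3)s − |c|)`
  have key : 2 / 9 * Real.sqrt 6 * ((a ^ 2 + b ^ 2 + c ^ 2) * s) -
      (4 * (a * b * |c|) + 8 / 9 * Real.sqrt 6 * s * ((a ^ 2 + b ^ 2 + c ^ 2) - 3 / 2 * c ^ 2)) =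
      4 * (a * b) * (Real.sqrt 6 / 3 * s - |c|) := by
    rw [hc]; ring
  have hprod : 0 ≤ 4 * (a * b) * (Real.sqrt 6 / 3 * s - |c|) :=
    mul_nonneg (mul_nonneg (by norm_num) hab) (sub_nonneg.2 hcle)
  rw [habs]
  linarith [key, hprod]

/-! ### 2. The uniaxial shape with a prescribed axis: an exact identity -/

/-- **Distance to the uniaxial shape with axis `e`.** For a trace-free real `3 × 3` array `W` (no symmetry
needed) and a unit vector `e` (`Σ eᵢ² = 1`) with Rayleigh quotient `μ = Σᵢⱼ eᵢ Wᵢⱼ eⱼ`: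
`Σᵢⱼ (Wᵢⱼ − (μ/2)(3eᵢeⱼ − δᵢⱼ))² = Σᵢⱼ Wᵢⱼ² − (3/2)μ²`. In particular `μ² ≤ (2/3)|W|²_F` (the operator-norm
link `abs_quadForm_sym_le` of the depletion chain) with deficit EXACTLY the squared Frobenius distance of `W`
from `(μ/2)(3e⊗e − I)`, the trace-free uniaxial shape with axis `e` (eigenvalue `μ` along `e`, `−μ/2` across).
[folklore] -/
theorem frobeniusSq_sub_uniaxial (W : Matrix (Fin 3) (Fin 3) ℝ) (htr : W.trace = 0) (e : Fin 3 → ℝ)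
    (he : ∑ i, e i ^ 2 = 1) :
    ∑ i, ∑ j, (W i j - (e ⬝ᵥ W *ᵥ e) / 2 * (3 * (e i * e j) - (1 : Matrix (Fin 3) (Fin 3) ℝ) i j)) ^ 2 =
      (∑ i, ∑ j, W i j ^ 2) - 3 / 2 * (e ⬝ᵥ W *ᵥ e) ^ 2 := by
  have htr' : W 0 0 + W 1 1 + W 2 2 = 0 := by
    simpa [Matrix.trace, Fin.sum_univ_three] using htr
  have he' : e 0 ^ 2 + e 1 ^ 2 + e 2 ^ 2 = 1 := by simpa [Fin.sum_univ_three] using he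
  have hμ : e ⬝ᵥ W *ᵥ e = ∑ i, ∑ j, e i * W i j * e j := by
    simp only [dotProduct, mulVec, Finset.mul_sum]
    exact Finset.sum_congr rfl fun i _ => Finset.sum_congr rfl fun j _ => by ring
  rw [hμ]
  simp only [Fin.sum_univ_three, Matrix.one_apply_eq, Fin.isValue,
    Matrix.one_apply_ne (show (0 : Fin 3) ≠ 1 by decide), Matrix.one_apply_ne (show (0 : Fin 3) ≠ 2 by decide),
    Matrix.one_apply_ne (show (1 : Fin 3) ≠ 0 by decide), Matrix.one_apply_ne (show (1 : Fin 3) ≠ 2 by decide),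
    Matrix.one_apply_ne (show (2 : Fin 3) ≠ 0 by decide), Matrix.one_apply_ne (show (2 : Fin 3) ≠ 1 by decide)]
  -- with `μ := Σ eᵢWᵢⱼeⱼ`, `n := Σ eᵢ²`: LHS − RHS = μ·tr W + (3μ²/4)(3n + 1)(n − 1)
  set μ : ℝ := e 0 * W 0 0 * e 0 + e 0 * W 0 1 * e 1 + e 0 * W 0 2 * e 2 +
      (e 1 * W 1 0 * e 0 + e 1 * W 1 1 * e 1 + e 1 * W 1 2 * e 2) +
      (e 2 * W 2 0 * e 0 + e 2 * W 2 1 * e 1 + e 2 * W 2 2 * e 2) with hμdef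
  linear_combination μ * htr' + (3 * μ ^ 2 / 4) * (3 * (e 0 ^ 2 + e 1 ^ 2 + e 2 ^ 2) + 1) * he'

/-! ### 3. Miller's bound with stability -/

/-- Assembly step: given the spectral data in scalar form — `det W = abc`, `|W|² = a²+b²+c²`, `a+b+c = 0`,
`ab ≥ 0` — and a unit vector `e` with Rayleigh quotient `c`, the stability inequality for `W` follows from
`millerStability_scalar` and `frobeniusSq_sub_uniaxial`. [folklore] -/
theorem miller_det_stability_of_spectralData (W : Matrix (Fin 3) (Fin 3) ℝ) (htr : W.trace = 0)
    {a b c : ℝ} (habc : a + b + c = 0) (hab : 0 ≤ a * b) (hdet : W.det = a * b * c)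
    (hσ : ∑ i, ∑ j, W i j ^ 2 = a ^ 2 + b ^ 2 + c ^ 2) (e : Fin 3 → ℝ) (he : ∑ i, e i ^ 2 = 1)
    (hray : e ⬝ᵥ W *ᵥ e = c) :
    4 * |W.det| + 8 / 9 * Real.sqrt 6 * Real.sqrt (∑ i, ∑ j, W i j ^ 2) *
        ∑ i, ∑ j, (W i j - (e ⬝ᵥ W *ᵥ e) / 2 * (3 * (e i * e j) - (1 : Matrix (Fin 3) (Fin 3) ℝ) i j)) ^ 2 ≤
      2 / 9 * Real.sqrt 6 * ((∑ i, ∑ j, W i j ^ 2) * Real.sqrt (∑ i, ∑ j, W i j ^ 2)) := by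
  rw [frobeniusSq_sub_uniaxial W htr e he, hray, hdet, hσ]
  exact millerStability_scalar habc hab

/-- **MILLER'S DETERMINANT BOUND WITH A SHARP STABILITY TERM.** Let `W` be a real symmetric trace-free
`3 × 3` matrix, `|W|² = Σᵢⱼ Wᵢⱼ²`. There is a unit vector `e` (an eigenvector for the eigenvalue of the odd sign,
which has maximal modulus) such that, with `μ = eᵀWe` and `U = (μ/2)(3e⊗e − I)` the trace-free uniaxial shape with
axis `e`:  `4|det W| + (8√6/9)·|W|·|W − U|²_F ≤ (2√6/9)·|W|³`.
So Miller's inequality `|4 det W| ≤ (2√6/9)|W|³` (Prop. 4.8; `abs_four_det_sym_le`) is an equality iff `W`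
is uniaxial (`W = U`), and near-equality `4|det W| ≥ (1−ε)(2√6/9)|W|³` forces `|W − U|² ≤ (ε/4)|W|²`.
Proof: spectral theorem (`det W = λ₀λ₁λ₂`, `|W|² = Σλᵢ²`, `Σλᵢ = 0`), two eigenvalues have a nonnegative
product, the third one's eigenvector is `e`; then `millerStability_scalar` + `frobeniusSq_sub_uniaxial`.
[folklore] -/
theorem miller_det_stability (W : Matrix (Fin 3) (Fin 3) ℝ) (hW : W.IsSymm) (htr : W.trace = 0) :
    ∃ e : Fin 3 → ℝ, ∑ i, e i ^ 2 = 1 ∧ W *ᵥ e = (e ⬝ᵥ W *ᵥ e) • e ∧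
      4 * |W.det| + 8 / 9 * Real.sqrt 6 * Real.sqrt (∑ i, ∑ j, W i j ^ 2) *
          ∑ i, ∑ j, (W i j - (e ⬝ᵥ W *ᵥ e) / 2 * (3 * (e i * e j) - (1 : Matrix (Fin 3) (Fin 3) ℝ) i j)) ^ 2 ≤
        2 / 9 * Real.sqrt 6 * ((∑ i, ∑ j, W i j ^ 2) * Real.sqrt (∑ i, ∑ j, W i j ^ 2)) := by
  have hH : W.IsHermitian := isHermitian_of_isSymm hW
  set lam := hH.eigenvalues with hlam
  have hdet : W.det = ∏ i, lam i := by
    have := hH.det_eq_prod_eigenvalues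
    simpa [RCLike.ofReal_real_eq_id] using this
  have htr' : ∑ i, lam i = 0 := by
    have := hH.trace_eq_sum_eigenvalues
    simp only [RCLike.ofReal_real_eq_id, id_eq] at this
    rw [← this, htr]
  have hsq : ∑ i, ∑ j, W i j ^ 2 = ∑ i, lam i ^ 2 := sum_sq_eq_sum_eigenvalues_sq hW
  simp only [Fin.sum_univ_three, Fin.prod_univ_three] at hdet htr' hsq
  -- the eigenvectors: unit, eigen-equation, Rayleigh quotient
  have hunit : ∀ k : Fin 3, ∑ i, (hH.eigenvectorBasis k).ofLp i ^ 2 = 1 := by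
    intro k
    have h := KyFan.eigenvectorBasis_dotProduct hH k k
    rw [if_pos rfl] at h
    simpa [dotProduct, sq] using h
  have heig : ∀ k : Fin 3, W *ᵥ (hH.eigenvectorBasis k).ofLp =
      ((hH.eigenvectorBasis k).ofLp ⬝ᵥ W *ᵥ (hH.eigenvectorBasis k).ofLp) • (hH.eigenvectorBasis k).ofLp ∧
      (hH.eigenvectorBasis k).ofLp ⬝ᵥ W *ᵥ (hH.eigenvectorBasis k).ofLp = lam k := by
    intro k
    have hmv := hH.mulVec_eigenvectorBasis k
    have hdot : (hH.eigenvectorBasis k).ofLp ⬝ᵥ W *ᵥ (hH.eigenvectorBasis k).ofLp = lam k := by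
      have h1 := KyFan.eigenvectorBasis_dotProduct hH k k
      rw [if_pos rfl] at h1
      rw [hmv, dotProduct_smul, h1, smul_eq_mul, mul_one]
    exact ⟨by rw [hdot]; exact hmv, hdot⟩
  -- restate the sum-of-squares identity with `Fin.sum_univ_three` undone for the assembly lemma
  have hsq' : ∑ i, ∑ j, W i j ^ 2 = lam 0 ^ 2 + lam 1 ^ 2 + lam 2 ^ 2 := by
    rw [sum_sq_eq_sum_eigenvalues_sq hW]; simp [Fin.sum_univ_three, hlam]
  rcases exists_pair_mul_nonneg (lam 0) (lam 1) (lam 2) with h01 | h02 | h12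
  · -- `c = lam 2`
    refine ⟨(hH.eigenvectorBasis 2).ofLp, hunit 2, (heig 2).1, ?_⟩
    refine miller_det_stability_of_spectralData W htr (a := lam 0) (b := lam 1) (c := lam 2)
      (by linarith) h01 (by rw [hdet]) hsq' _ (hunit 2) (heig 2).2
  · -- `c = lam 1`
    refine ⟨(hH.eigenvectorBasis 1).ofLp, hunit 1, (heig 1).1, ?_⟩
    refine miller_det_stability_of_spectralData W htr (a := lam 0) (b := lam 2) (c := lam 1)
      (by linarith) h02 (by rw [hdet]; ring) (by rw [hsq']; ring) _ (hunit 1) (heig 1).2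
  · -- `c = lam 0`
    refine ⟨(hH.eigenvectorBasis 0).ofLp, hunit 0, (heig 0).1, ?_⟩
    refine miller_det_stability_of_spectralData W htr (a := lam 1) (b := lam 2) (c := lam 0)
      (by linarith) h12 (by rw [hdet]; ring) (by rw [hsq']; ring) _ (hunit 0) (heig 0).2

/-- **Sharpness of the stability constant `8√6/9`: plane strain.** For `W = diag(1, 0, −1)` (`det W = 0`,
`|W|² = 2`) and EVERY unit vector `e`, the stability term is at least the right-hand side:
`(8√6/9)√2·(2 − (3/2)μ²) ≥ (2√6/9)·2√2` since `μ = e₀² − e₂² ∈ [−1, 1]`; so no constant larger than `8√6/9`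
can multiply the squared distance in `miller_det_stability`. (At the uniaxial shapes both the determinant term
and Miller's right-hand side agree and the distance vanishes — the other equality configuration.) [folklore] -/
theorem miller_det_stability_sharp_planeStrain (e : Fin 3 → ℝ) (he : ∑ i, e i ^ 2 = 1) :
    2 / 9 * Real.sqrt 6 * ((2 : ℝ) * Real.sqrt 2) ≤
      8 / 9 * Real.sqrt 6 * Real.sqrt 2 *
        ((2 : ℝ) - 3 / 2 * (e ⬝ᵥ (Matrix.diagonal ![(1 : ℝ), 0, -1]) *ᵥ e) ^ 2) := by
  have he' : e 0 ^ 2 + e 1 ^ 2 + e 2 ^ 2 = 1 := by simpa [Fin.sum_univ_three] using he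
  have hμ : e ⬝ᵥ (Matrix.diagonal ![(1 : ℝ), 0, -1]) *ᵥ e = e 0 ^ 2 - e 2 ^ 2 := by
    have v2 : (![(1 : ℝ), 0, -1]) 2 = -1 := rfl
    simp [dotProduct, mulVec_diagonal, Fin.sum_univ_three, v2]
    ring
  rw [hμ]
  have hμ1 : (e 0 ^ 2 - e 2 ^ 2) ^ 2 ≤ 1 := by
    nlinarith [sq_nonneg (e 0), sq_nonneg (e 1), sq_nonneg (e 2)]
  have h0 : 0 ≤ Real.sqrt 6 * Real.sqrt 2 := by positivity
  nlinarith [h0]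

/-! ### 4. The `(g, s)`-array vocabulary of `…StrainCubePointwise` -/

/-- **Miller's bound with stability for the symmetric part of a trace-free array** (the vocabulary of
`abs_four_det_sym_le`: `g` a trace-free `3 × 3` array — the velocity gradient —, `s` its symmetric part): there is
a unit vector `e` with `s·e = μe`, `μ = eᵀse`, and
`|4 det s| + (8√6/9)·√(|s|²)·Σᵢⱼ(sᵢⱼ − (μ/2)(3eᵢeⱼ − δᵢⱼ))² ≤ (2√6/9)|s|²√(|s|²)`. [folklore] -/
theorem abs_four_det_sym_stability (g s : Fin 3 → Fin 3 → ℝ) (hs : ∀ i j, s i j = (g i j + g j i) / 2)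
    (htr : g 0 0 + g 1 1 + g 2 2 = 0) :
    ∃ e : Fin 3 → ℝ, ∑ i, e i ^ 2 = 1 ∧
      (Matrix.of fun i j => s i j) *ᵥ e = (e ⬝ᵥ (Matrix.of fun i j => s i j) *ᵥ e) • e ∧
      |4 * (Matrix.of fun i j => s i j).det| +
          8 / 9 * Real.sqrt 6 * Real.sqrt (∑ i, ∑ j, s i j ^ 2) *
            ∑ i, ∑ j, (s i j - (e ⬝ᵥ (Matrix.of fun i j => s i j) *ᵥ e) / 2 *
              (3 * (e i * e j) - (1 : Matrix (Fin 3) (Fin 3) ℝ) i j)) ^ 2 ≤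
        2 / 9 * Real.sqrt 6 * ((∑ i, ∑ j, s i j ^ 2) * Real.sqrt (∑ i, ∑ j, s i j ^ 2)) := by
  set S : Matrix (Fin 3) (Fin 3) ℝ := Matrix.of fun i j => s i j with hS
  have hsym : S.IsSymm := isSymm_of_sym g s hs
  have htrS : S.trace = 0 := trace_of_sym g s hs htr
  obtain ⟨e, he, heig, hstab⟩ := miller_det_stability S hsym htrS
  refine ⟨e, he, heig, ?_⟩
  have hF : ∀ i j, S i j = s i j := fun i j => rfl
  simp only [hF] at hstab
  rw [abs_mul, show |(4 : ℝ)| = 4 by norm_num]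
  exact hstab

end Summit.NavierStokesRegularity.NavierStokesRegularity.Theorems.DepletionLadder.StrainCube

end
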